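import Summits.ResolutionOfSingularities.ResolutionOfSingularities.Theorems.PurelyInseparableDim4ChartAtlasSNCFarRepairTranslated
import Summits.ResolutionOfSingularities.ResolutionOfSingularities.Theorems.PurelyInseparableDim4ChartAtlasSNCDisjointRepairs
import HarnessLib

/-!
# Purely inseparable four-folds `z^p + F(x₁, …, x₄)`: THE FAR-RESONANCE REPAIR AT TWO HEIGHTS IN ONE STEP — after one blow-up along
# `Σ′ ⊔ Σ″` the strict transform of the escaping centre is admissible (cell `res-dim4-pi`, typ-2 g7; HANDOFF OPEN 2, memo
# S3-N2-SNC-CRITERION §11:20Z, files F2+F3 — the chart-model instance of p716496 `…ChartAtlasSNCDisjointRepairs`)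

[OURS · counted 0] (D-0157 DOOR 2; DR-157-C.) Chart model of the escaping step in R1's frame (p706678: `y_j ↦ y_j − c′`, first resonant height
at `y_j = 0`, old exceptional hyperplane at `y_j = c′`): boundary `E` of hyperplanes `(y_m + a)·𝒪`, `(m, a) ∈ H₀`, and translated far
quadrics `TQ_k = ((y_k + b_k)·y_j − c′·y_k + e_k)·𝒪`, `k ∈ fs ∌ j`, `e_k + b_k c′ ≠ 0`; escaping centre `Zc = V(y_0, y_T)` (`j ∉ T`); the
resonance loci `Σ′ = Zc ∩ {y_j = 0}` (members `TQ_k`, `k ∈ T`, `e_k = 0`, and the far hyperplane `y_j`) and `Σ″ = Zc ∩ {y_j = δ}` (members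
with `e_k + b_k δ = 0`, and a hyperplane `y_j − δ`), `δ ≠ 0`, `δ ≠ c′`; `C₁ = 𝓘(Σ′)`, `C₂ = ψ^*C₁ = 𝓘(Σ″)` for the translation
`ψ : y_j ↦ y_j − δ` (F1 p715277: `Σ′ ⊔ Σ″ = V(C₁·C₂)` is regular and snc with `E`). PROVED here (no `sorry`, no new axiom):

* **`admissible_strictTransform_after_twoHeights_farRepair`** — for ANY blowing up `π` of `𝔸⁵` along `C₁·C₂`, `C' = St_π(Zc)` is REGULAR,
  `V(C') ⊆ supp M'` for `M' = ((z^p + F)·𝒪, E, p).transform π (C₁C₂)`, and `HasSNCWith M'.boundary C'` — under R4's provenance hypotheses with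
  the height conditions asked only OFF the two resonant heights (hyperplanes `y_j + a` with `a ≠ 0, −δ`; active far members with `e_k ≠ 0`
  and `e_k + b_k δ ≠ 0`). Assembly: p716496 `admissible_strictTransform_of_disjoint_repairs` fed with R5 (p709208) for `C₁` with the boundary
  minus the height-`δ` members, and with R5 at the second height (`admissible_strictTransform_after_farRepair_translated`) for `C₂` with the
  boundary minus the height-`0` members; the removed members meet `Zc` only inside `Σ″` resp. `Σ′`.

WORDS: «resonances of the escaping centre with far old members at two different heights are removed by ONE extra blow-up along the disjoint
union of the two resonance loci; afterwards the strict transform of the centre is admissible; cost rider r5 once per height». `k ≥ 3`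
heights: the same two files, by induction on the finite set of heights (not typed). Nothing here is a statement about resolution of
singularities in dimension ≥ 4 / characteristic `p` (NOT proved anywhere in this programme). bears_on: LADDER-RESOLUTION:D157-DOOR2 (res-dim4-pi).
Supports stmt-ResolutionOfSingularities-16155 (helper).
-/

-- every declaration of this summit lives under `Summit.ResolutionOfSingularities.ResolutionOfSingularities`
-- (summit = problem), which the duplicate-namespace linter flags; house convention (cf. the Target file).
set_option linter.dupNamespace false

noncomputable section

open MvPolynomial CategoryTheory AlgebraicGeometry TopologicalSpace
open AlgebraicGeometry.Scheme.IdealSheafData (ofIdealTop)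

namespace Summit.ResolutionOfSingularities.ResolutionOfSingularities.Theorems.PIDim4

open Literature.AlgebraicGeometry.Resolution
open Literature.AlgebraicGeometry.Resolution.AffinePointBlowup (P A γ)

namespace ChartDictionary

variable {K : Type} [Field K] {p : ℕ} {T : Finset (Fin 4)} {j : Fin 4} {b e : Fin 4 → K} {c' δ : K}

/-- **THE FAR-RESONANCE REPAIR AT TWO HEIGHTS IN ONE STEP** (chart model, R1's frame `y_j ↦ y_j − c′`; `j ∉ T`, `c′ ≠ 0`, second height
`δ ≠ 0, c′`). Boundary: hyperplanes `(m, a) ∈ H₀` (provenance `(k⁺, a) ∈ H₀ → a = b_k` on far indices) and translated far quadrics `TQ_k`,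
`k ∈ fs ∌ j`, `e_k + b_k c′ ≠ 0`; the height conditions are asked only OFF the two resonant heights: no index-`j` hyperplane `y_j + a`,
`a ≠ 0, −δ`, at the height of an active member with `e_k ≠ 0`, `e_k + b_k δ ≠ 0`, and pairwise distinct heights among those members. Then for
ANY blowing up `π : W → 𝔸⁵` along `C₁·C₂ = 𝓘(Σ′)·ψ^*𝓘(Σ′)` (zero scheme `Σ′ ⊔ Σ″`, regular and snc with the boundary by F1 p715277):
`C' = St_π(V(y_0, y_T))` is REGULAR, `V(C') ⊆ supp M'` for `M' = ((z^p + F)·𝒪, E, p).transform π (C₁C₂)` (`z^p + F` `T`-permissible, `T ≠ ∅`),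
and `HasSNCWith M'.boundary C'` — the strict transform of the escaping centre is an ADMISSIBLE centre after ONE extra blow-up removing the
resonances at both heights. Assembly of p716496 with R5 (members at height `δ` removed) and R5 at the second height (members at height `0`
removed). Resolution of singularities in dimension ≥ 4 / characteristic `p` is NOT proved. -/
theorem admissible_strictTransform_after_twoHeights_farRepair (hjT : j ∉ T) (hc' : c' ≠ 0) (hδ : δ ≠ 0) (hc'δ : c' - δ ≠ 0)
    (H₀ : Finset (Fin (4 + 1) × K)) (fs : Finset (Fin 4)) (hjfs : j ∉ fs) (hd : ∀ k ∈ fs, e k + b k * c' ≠ 0)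
    (hC1 : ∀ k ∈ fs, ∀ a : K, (k.succ, a) ∈ H₀ → a = b k)
    (hHj : ∀ a : K, (j.succ, a) ∈ H₀ → a ≠ 0 → a + δ ≠ 0 →
      ∀ k ∈ fs, k ∈ T → e k ≠ 0 → e k + b k * δ ≠ 0 → b k ≠ 0 → e k ≠ a * b k)
    (hNh : ∀ k ∈ fs, ∀ k' ∈ fs, k ∈ T → k' ∈ T → e k ≠ 0 → e k' ≠ 0 → e k + b k * δ ≠ 0 → e k' + b k' * δ ≠ 0 → k ≠ k' →
      b k ≠ 0 → b k' ≠ 0 → e k * b k' ≠ e k' * b k)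
    {k₀ : Fin 4} (hk₀ : k₀ ∈ T) {E : List (Scheme.IdealSheafData (P 4 K))}
    (hE : ∀ D ∈ E, D = ⊤ ∨ (∃ ma ∈ H₀, D = ofIdealTop (Ideal.span {(γ 4 K).symm (X ma.1 + C ma.2)})) ∨
      ∃ k ∈ fs, D = ofIdealTop (Ideal.span {(γ 4 K).symm ((X k.succ + C (b k)) * X j.succ - C c' * X k.succ + C (e k))}))
    (F : MvPolynomial (Fin 4) K) (hperm : (p : ℕ∞) ≤ CentreBlowup.ordAlong T F) {W : Scheme.{0}} {π : W ⟶ P 4 K}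
    (hπ : IsBlowup π
      (AffineCoordBlowup.𝓘Λ 4 K (insert 0 (Fin.succ '' ((insert j T : Finset (Fin 4)) : Set (Fin 4)))) *
        (AffineCoordBlowup.𝓘Λ 4 K (insert 0 (Fin.succ '' ((insert j T : Finset (Fin 4)) : Set (Fin 4))))).comap
          (Spec.map (CommRingCat.ofHom ((AffinePointBlowup.translateEquiv (n := 4) (Pi.single j.succ (-δ)) : A 4 K ≃ₐ[K] A 4 K) :
            A 4 K →+* A 4 K))))) :
    let C₁ := AffineCoordBlowup.𝓘Λ 4 K (insert 0 (Fin.succ '' ((insert j T : Finset (Fin 4)) : Set (Fin 4))))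
    let C₂ := C₁.comap (Spec.map (CommRingCat.ofHom
      ((AffinePointBlowup.translateEquiv (n := 4) (Pi.single j.succ (-δ)) : A 4 K ≃ₐ[K] A 4 K) : A 4 K →+* A 4 K)))
    let M' := (⟨hypSheaf p F, E, p⟩ : MarkedIdeal (P 4 K)).transform π (C₁ * C₂)
    let C' := strictTransformIdeal π (C₁ * C₂) (AffineCoordBlowup.𝓘Λ 4 K (insert 0 (Fin.succ '' (T : Set (Fin 4)))))
    Scheme.IsRegular C'.subscheme ∧ (C'.support : Set W) ⊆ M'.support ∧ HasSNCWith M'.boundary C' := by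
  intro C₁ C₂ M' C'
  classical
  set Λ : Set (Fin (4 + 1)) := insert 0 (Fin.succ '' ((insert j T : Finset (Fin 4)) : Set (Fin 4))) with hΛ
  set ΛT : Set (Fin (4 + 1)) := insert 0 (Fin.succ '' (T : Set (Fin 4))) with hΛT
  -- F1: `Σ′ ⊔ Σ″` is a disjoint union, snc with `E`
  obtain ⟨hdisj, h12, -⟩ := hasSNCWith_twoHeights_of_forall_mem_far_translated hjT hc' hδ hc'δ H₀ fs hjfs hd hC1 hE
  -- the reduced families: off height `δ` (index 1) and off height `0` (index 2)
  set H₁ := H₀.filter fun ma => ¬ (ma.1 = j.succ ∧ ma.2 + δ = 0) with hH₁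
  set fs₁ := fs.filter fun k => ¬ (k ∈ T ∧ e k + b k * δ = 0) with hfs₁
  set H₂ := H₀.filter fun ma => ¬ (ma.1 = j.succ ∧ ma.2 = 0) with hH₂
  set fs₂ := fs.filter fun k => ¬ (k ∈ T ∧ e k = 0) with hfs₂
  let P₁ : Scheme.IdealSheafData (P 4 K) → Prop := fun D =>
    D = ⊤ ∨ (∃ ma ∈ H₁, D = ofIdealTop (Ideal.span {(γ 4 K).symm (X ma.1 + C ma.2)})) ∨
      ∃ k ∈ fs₁, D = ofIdealTop (Ideal.span {(γ 4 K).symm ((X k.succ + C (b k)) * X j.succ - C c' * X k.succ + C (e k))})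
  let P₂ : Scheme.IdealSheafData (P 4 K) → Prop := fun D =>
    D = ⊤ ∨ (∃ ma ∈ H₂, D = ofIdealTop (Ideal.span {(γ 4 K).symm (X ma.1 + C ma.2)})) ∨
      ∃ k ∈ fs₂, D = ofIdealTop (Ideal.span {(γ 4 K).symm ((X k.succ + C (b k)) * X j.succ - C c' * X k.succ + C (e k))})
  set E₁ := E.filter fun D => decide (P₁ D) with hE₁
  set E₂ := E.filter fun D => decide (P₂ D) with hE₂
  have hmem₁ : ∀ D ∈ E₁, P₁ D := fun D hD => of_decide_eq_true (List.mem_filter.mp hD).2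
  have hmem₂ : ∀ D ∈ E₂, P₂ D := fun D hD => of_decide_eq_true (List.mem_filter.mp hD).2
  have hnot₁ : ∀ D ∈ E, D ∉ E₁ → ¬ P₁ D := fun D hD hD₁ h => hD₁ (List.mem_filter.mpr ⟨hD, decide_eq_true h⟩)
  have hnot₂ : ∀ D ∈ E, D ∉ E₂ → ¬ P₂ D := fun D hD hD₂ h => hD₂ (List.mem_filter.mpr ⟨hD, decide_eq_true h⟩)
  have hjfs₁ : j ∉ fs₁ := fun h => hjfs (Finset.mem_filter.mp h).1
  have hjfs₂ : j ∉ fs₂ := fun h => hjfs (Finset.mem_filter.mp h).1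
  -- `b_k ≠ 0` for a member resonant at some height
  have hbk : ∀ k ∈ fs, ∀ h : K, e k + b k * h = 0 → b k ≠ 0 := by
    intro k hk h hek hb
    refine hd k hk ?_
    rw [hb, zero_mul, add_zero] at hek
    rw [hek, hb, zero_mul, add_zero]
  refine admissible_strictTransform_of_disjoint_repairs hdisj (⟨hypSheaf p F, E, p⟩ : MarkedIdeal (P 4 K)) (E₁ := E₁) (E₂ := E₂)
    h12 ?_ ?_ ?_ ?_ hπ
  · -- the repair at height `0`: R5 with the boundary off height `δ`
    intro X₁ τ hτ
    have h := admissible_strictTransform_after_farRepair (b := b) (e := e) (c' := c') hjT hc' H₁ fs₁ hjfs₁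
      (fun k hk => hd k (Finset.mem_filter.mp hk).1)
      (fun k hk a ha => hC1 k (Finset.mem_filter.mp hk).1 a (Finset.mem_filter.mp ha).1) ?_ ?_ hk₀ hmem₁ F hperm hτ
    · exact ⟨h.1, h.2.1, by simpa only [MarkedIdeal.transform_boundary] using h.2.2⟩
    · intro a ha ha0 k hk hkT hek hbk'
      obtain ⟨ha', hna⟩ := Finset.mem_filter.mp ha
      obtain ⟨hk', hnk⟩ := Finset.mem_filter.mp hk
      exact hHj a ha' ha0 (fun h' => hna ⟨rfl, h'⟩) k hk' hkT hek (fun h' => hnk ⟨hkT, h'⟩) hbk'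
    · intro k hk k' hk' hkT hk'T hek hek' hkk hbk₁ hbk₂
      obtain ⟨hk₁, hnk⟩ := Finset.mem_filter.mp hk
      obtain ⟨hk₂, hnk'⟩ := Finset.mem_filter.mp hk'
      exact hNh k hk₁ k' hk₂ hkT hk'T hek hek' (fun h' => hnk ⟨hkT, h'⟩) (fun h' => hnk' ⟨hk'T, h'⟩) hkk hbk₁ hbk₂
  · -- the members AT height `δ` meet `Zc` only inside `Σ″`
    intro D hD hD₁ x hx
    have hn := hnot₁ D hD hD₁
    obtain ⟨hxD, hxZ⟩ := hx
    rw [SetLike.mem_coe, AffineCoordBlowup.support_𝓘Λ, AffineCoordBlowup.mem_CΛ_iff'] at hxZ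
    rw [SetLike.mem_coe, mem_support_comap_spec_translate_𝓘Λ_iff]
    rcases hE D hD with h | ⟨ma, hma, h⟩ | ⟨k, hk, h⟩
    · exact absurd (Or.inl h) hn
    · have hjδ : ma.1 = j.succ ∧ ma.2 + δ = 0 := by
        by_contra hc
        exact hn (Or.inr (Or.inl ⟨ma, Finset.mem_filter.mpr ⟨hma, hc⟩, h⟩))
      rw [h, SetLike.mem_coe, mem_support_ofIdealTop_span_γ_symm_iff, hjδ.1, eq_neg_of_add_eq_zero_left hjδ.2] at hxD
      exact X_add_C_mem_insert_of_hyperplane_mem hjT x (-δ) hxD hxZ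
    · have hkδ : k ∈ T ∧ e k + b k * δ = 0 := by
        by_contra hc
        exact hn (Or.inr (Or.inr ⟨k, Finset.mem_filter.mpr ⟨hk, hc⟩, h⟩))
      rw [h, SetLike.mem_coe, mem_support_ofIdealTop_span_γ_symm_iff] at hxD
      have hXk : (X k.succ : A 4 K) ∈ x.asIdeal := hxZ k.succ (Set.mem_insert_of_mem _ ⟨k, Finset.mem_coe.mpr hkδ.1, rfl⟩)
      exact X_add_C_mem_insert_of_hyperplane_mem hjT x (-δ) (X_add_C_mem_of_tquadric_mem x (hbk k hk δ hkδ.2) hkδ.2 hxD hXk) hxZ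
  · -- the repair at height `δ`: R5 at the second height with the boundary off height `0`
    intro X₂ τ hτ
    refine admissible_strictTransform_after_farRepair_translated (b := b) (e := e) (c' := c') (δ := δ) hjT hc'δ H₂ fs₂ hjfs₂
      (fun k hk => hd k (Finset.mem_filter.mp hk).1)
      (fun k hk a ha => hC1 k (Finset.mem_filter.mp hk).1 a (Finset.mem_filter.mp ha).1) ?_ ?_ hk₀ hmem₂ F hperm hτ
    · intro a ha haδ k hk hkT hekδ hbk'
      obtain ⟨ha', hna⟩ := Finset.mem_filter.mp ha
      obtain ⟨hk', hnk⟩ := Finset.mem_filter.mp hk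
      exact hHj a ha' (fun h' => hna ⟨rfl, h'⟩) haδ k hk' hkT (fun h' => hnk ⟨hkT, h'⟩) hekδ hbk'
    · intro k hk k' hk' hkT hk'T hekδ hek'δ hkk hbk₁ hbk₂
      obtain ⟨hk₁, hnk⟩ := Finset.mem_filter.mp hk
      obtain ⟨hk₂, hnk'⟩ := Finset.mem_filter.mp hk'
      exact hNh k hk₁ k' hk₂ hkT hk'T (fun h' => hnk ⟨hkT, h'⟩) (fun h' => hnk' ⟨hk'T, h'⟩) hekδ hek'δ hkk hbk₁ hbk₂
  · -- the members AT height `0` meet `Zc` only inside `Σ′`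
    intro D hD hD₂ x hx
    have hn := hnot₂ D hD hD₂
    obtain ⟨hxD, hxZ⟩ := hx
    rw [SetLike.mem_coe, AffineCoordBlowup.support_𝓘Λ, AffineCoordBlowup.mem_CΛ_iff'] at hxZ
    rw [SetLike.mem_coe, AffineCoordBlowup.support_𝓘Λ, AffineCoordBlowup.mem_CΛ_iff']
    have key : (X j.succ + C (0 : K) : A 4 K) ∈ x.asIdeal → ∀ i ∈ Λ, (X i : A 4 K) ∈ x.asIdeal := fun hj i hi => by
      have h := X_add_C_mem_insert_of_hyperplane_mem hjT x 0 hj hxZ i hi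
      rwa [Pi.single_zero, Pi.zero_apply, C_0, add_zero] at h
    rcases hE D hD with h | ⟨ma, hma, h⟩ | ⟨k, hk, h⟩
    · exact absurd (Or.inl h) hn
    · have hj0 : ma.1 = j.succ ∧ ma.2 = 0 := by
        by_contra hc
        exact hn (Or.inr (Or.inl ⟨ma, Finset.mem_filter.mpr ⟨hma, hc⟩, h⟩))
      rw [h, SetLike.mem_coe, mem_support_ofIdealTop_span_γ_symm_iff, hj0.1, hj0.2] at hxD
      exact key hxD
    · have hk0 : k ∈ T ∧ e k = 0 := by
        by_contra hc
        exact hn (Or.inr (Or.inr ⟨k, Finset.mem_filter.mpr ⟨hk, hc⟩, h⟩))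
      rw [h, SetLike.mem_coe, mem_support_ofIdealTop_span_γ_symm_iff] at hxD
      have hXk : (X k.succ : A 4 K) ∈ x.asIdeal := hxZ k.succ (Set.mem_insert_of_mem _ ⟨k, Finset.mem_coe.mpr hk0.1, rfl⟩)
      have hek : e k + b k * 0 = 0 := by rw [mul_zero, add_zero]; exact hk0.2
      have hj := X_add_C_mem_of_tquadric_mem x (hbk k hk 0 hek) hek hxD hXk
      rw [neg_zero] at hj
      exact key hj


end ChartDictionary

end Summit.ResolutionOfSingularities.ResolutionOfSingularities.Theorems.PIDim4

end
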